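import Literature.MathematicalPhysics.QuantumFieldTheory.Balaban1983to89.B9RWSums346Schur

/-!
# `Balaban1983to89.B9RWSums343Holder` — [B9] the Hölder member (3.43) of the random walk sum (3.107) G(U) PROVED inside
# the leaf of Theorem 3.10 at the all-blocks pin: the Hölder quotients (3.40) read as linear functionals of the output
# («probe lattices»), so that both members of (3.43) are two-space sup majorants of the lineage's calculus

T. Bałaban, *Propagators for lattice gauge theories in a background field*, Commun. Math. Phys. **99** (1985) 389–434
[`Balaban1985BackgroundPropagators`, "B9"]; [4] = T. Bałaban, *Propagators and renormalization transformations for lattice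
gauge theories. II*, Commun. Math. Phys. **96** (1984) 223–250 [`Balaban1984PropagatorsII`].

statement-level skeleton of published theorems with citation tags; proofs where landed; nothing here is a claim about the
Yang–Mills mass gap

THE PRINTED LOCI (verbatim).  (3.43), p. 398: *"‖ζ∇_UG′(U)λ‖_β, ‖ζG′(U)∇\*_Uλ‖_β ≦ B₀(β₀)(L^jη)^{1−β}(‖ζ‖^ξ_β + |ζ|)
e^{−δ₀d(y,y′)}|λ|, ξ = L^{−j}, for 0 ≦ β ≦ β₀ < 1, ζ ∈ C₀^∞(Δ̃(y)), y ∈ Λ_j, supp λ ⊂ Δ(y′)"*; (3.40), p. 397: *"‖A‖_α =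
max_μ sup_{x,x′:|x−x′|≦1} |x′ − x|^{−α}|R(U(Γ_{x,x′}))A_μ(x′) − A_μ(x)|, where Γ_{x,x′} is a shortest contour connecting points x
and x′"*; Theorem 3.10, p. 416: *"… satisfies the inequality (3.108) and the corresponding inequalities for norms on the
left-hand sides of (3.42)–(3.47). … From (3.108) it follows that the expansion (3.107) is convergent in all norms in the
inequalities (3.42)–(3.47). This implies Theorem 3.3."*; p. 413: *"An operator R_α(X) … is localized in X, … depends on U
restricted to X̃⁵, and satisfies a bound of the type (3.89), possibly with an additional power of L^jη"*; (3.105)–(3.106)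
p. 414: *"Δ_aG₀ = I − R"*, *"G = G₀(I − R)⁻¹"*; Corollary 3.8 p. 410: *"Similar estimates hold for the other norms"*.

THE POINT.  The siblings `B9RWSums343to347Whole` ∕ `B9RWSums346Schur` inhabit the summation leaf at the ALL-BLOCKS pins and
prove, inside the leaves under their provisos, the (3.42) clauses, the (3.47) lines and the L² lines (3.46)₁,₂,₃ of the sums
from the four sup majorants; the Hölder block (3.43)–(3.45) stayed DISPLAYED (*"no reading of the block-norm engines into
`B9.KernelFamily.h1`"*).  THIS FILE proves the member (3.43) of the sum G(U) of (3.107).  The route is n06-b's remark in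
`B9Thm37AllNormsInstances` §3 (*"an `HasMaj` into a probe lattice IS the family of per-functional bounds"*) and r06's in
`B9Thm34HolderLeftFinal` (*"every (3.40)-type functional Φ"*): a transported Hölder difference quotient (3.40) with a cut-off
is ONE ℝ-linear functional of the output, so — indexing these functionals by a finite PROBE LATTICE P with anchors in 𝔅 —
the two members of (3.43) for an operator T are two-space sup majorants `B6RandomWalkHom.HasMajorantHom blk blkP (Φ_β ∘ T)
(B(β)(L^jη)^{1−β}e^{−δ₀d})` of the lineage's own calculus, and the random walk sum is summed in them exactly as in the sup
entries of `B9Thm310Whole.conv3107_of_local3107`: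

* §1 ENGINES (abstract operators, any lattices): `leftMember_of_localLegs` — a LEFT member E∘G of a right fixed point
  G = Σ_□T_□ + GR in ANY output lattice (E∘G = E∘G₀ + (E∘G)∘R, `B6RandomWalkHom.hom_majorant_of_fixedPoint_266`; the left
  step of `conv3107_of_local3107` made generic); `conv_exp_le_of_261` — the one-sided convolution Σ_z e^{−δ₀d(a,z)}e^{−δ′d(z,b)}
  ≦ c₁(α)e^{−δ′d(a,b)} for δ′ ≦ (1 − α)δ₀ ((2.54) + (2.61)); `rightMember_of_localLegs` — a member E∘T of a LEFT fixed point
  T = Σ_□T₀,□ + V∘T read through E: E∘T = E∘T₀ + (E∘V)∘T, the head legs plus ONE convolution of the probe bound of E∘V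
  (scale-weighted) with the sup majorant of T.
* §2 READINGS: `HolderProbes` (the probe letters Φ^X_β(U), Φ^Y_β(U) with their anchors — a PARAMETER RECORD), `H1Reads` (the
  co-reading of `K.h1` = max of the two quotients of (3.43) by the probe values, with the cut-off factor ‖ζ‖^ξ_β + |ζ| =
  `cutH β ζ`; pattern of `CoRealizes` ∕ `GlobReads` ∕ `L2Reads`), `line343_of_hasMajorantHom` (two probe majorants
  B(β)(L^jη)^{1−β}e^{−δ₀d} ⇒ the (3.43) line AS TYPED), `ineq343_345_of_lines`.
* §3 THE SUM G(U) OF (3.107) (letters `B9Thm310Whole.Ops310`): schemas `HolderLegs310` (Corollary 3.6's (3.43) for the head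
  terms h_□G_□h_□ read through Φ^Y_β∘∇_U and through Φ^X_β(·)∘∇\*_U, localized — POSITED, including the product rule of the
  quotient through h_□, exactly as the legs `hleg` of `B9Thm37AllNorms.thm37_left`), `FactorsHolder310` (the transposed factors
  R♯_a read through Φ^X_β: p. 413's *"bound of the type (3.89), possibly with an additional power of L^jη"*, POSITED),
  `holderConst`; `holder343_of_local310` — ONE member, ONE U: both probe majorants of the sum (left: (3.106) as the right fixed
  point G = G₀ + GR; right: the transposed (3.105) G∇\* = G₀∇\* + R♯(G∇\*), the entry-3 sup majorant of `Conv3107` and one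
  convolution); ★ `thm310Printed_allPin_schur_holder` — the leaf `B9.Thm310Printed` at `W310OfOps … (ConvAll3107 …)` with
  (3.42) + (3.47) + (3.46)₁,₂,₃ + (3.43) PROVED inside and ONLY (3.44), (3.45), (3.46)₄,₅,₆ displayed.

HONEST SCOPE.  Nothing of print is asserted.  The probe letters, the co-reading `H1Reads`, the Hölder legs of the head terms
and the Hölder-probe bounds of the transposed factors are HYPOTHESES of printed shape (Cor. 3.6 (3.43) for the G_□; p. 413 for
the R_α(X); the product rule of (3.40) through h_□ and the sizes of ∂h_□ are not displayed in print, cell GAPS G-pv21g4-1 (i),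
G-B9-05∕06a∕07); the INPUT-side Hölder members (3.44), (3.45) (GAPS G-B9-02∕07: no input-Hölder block norm in the two-space
calculus) and the L² lines (3.46)₄,₅,₆ ((Δ_UG)ᵀ = GΔ_U has no leg among Cor. 3.6's four) stay displayed.  Value: kernel-checked
bookkeeping shrinking a located residual; NOT a node discharge, NOT summit progress; one finite lattice paper; nothing
continuum, nothing about the mass gap.  Cell `pub-ymgap` (HUMAN RULING D-0062), Track A node N06 [B9], seat
`pub-ymgap-dag-n06-k` (N06-ASSIGNMENT v1 rows 18–19, successor gen), 2026-08-26.
-/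

namespace Literature.MathematicalPhysics.QuantumFieldTheory.Balaban1983to89.B9RWSums343Holder

open Literature.MathematicalPhysics.QuantumFieldTheory.Balaban1983to89
open Finset B6RandomWalk B6RandomWalkHom B9Thm37Sum B9Thm34Ext B9Thm37Glue B9Thm37Whole B9Cor38Whole B9Thm310Whole
open B9RWSums343to347Whole B9RWSums346Schur B9Thm37GlueCor36

noncomputable section

/-! ## §1 Engines: a left member of a right fixed point in any output lattice; one convolution; a member of a left fixed point -/

section Engines

variable {g : B9.Geometry} [Fintype g.Site] {R : ℝ} {H : Prop} {X Y Z : Type}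

/-- **A LEFT MEMBER OF THE EXPANSION IN AN ARBITRARY OUTPUT LATTICE** (the mechanism of p. 410 *"Similar estimates hold for
the other norms"* ∕ p. 416 *"the corresponding inequalities for norms on the left-hand sides of (3.42)–(3.47)"* for members
with the extra operator on the LEFT of the sum): if G = Σ_□T_□ + GR (the right fixed point (3.106) ∕ (3.90)), R has the sup
majorant θe^{−δ₀d} with θc₁(α) < 1, and each head term read through a linear E : (X → ℝ) → (Z → ℝ) into ANY lattice Z has the
localized majorant χ_□(y)·A·W(y)e^{−δ₀d(y,y′)} with Σ_□χ_□ ≦ N, then E∘G has majorant NAc₁(α)(1 − θc₁(α))⁻¹W(y)e^{−(1−α)δ₀d(y,y′)}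
— E∘G = E∘G₀ + (E∘G)∘R (`B6RandomWalkHom.leftEntry_fixpoint`) and [4] (2.66) for a left entry
(`B6RandomWalkHom.hom_majorant_of_fixedPoint_266`).  With Z = a probe lattice and E = Φ_β∘∇_U this is the left member of (3.43);
with Z = bonds, E = ∇_U it is the left step of `B9Thm310Whole.conv3107_of_local3107`.
[cite: Balaban1985BackgroundPropagators, Thm 3.10 (3.106)–(3.108) pp.414–416 + Cor. 3.8 p.410; Balaban1984PropagatorsII, Prop. 2.2 (2.66) p.234] -/
theorem leftMember_of_localLegs [Fintype X] [DecidableEq X] [Fintype Z] [DecidableEq Z] {ι : Type} [Fintype ι]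
    (blk : X → g.Site) (blkZ : Z → g.Site) (d : ℕ) (δ₀ α θ A N : ℝ) (W : g.Site → ℝ) (χ : ι → g.Site → ℝ)
    (hA : 0 ≤ A) (hN : 0 ≤ N) (hW : ∀ y, 0 ≤ W y) (hθ : 0 ≤ θ) (hδ₀ : 0 ≤ δ₀) (hα1 : α ≤ 1)
    (htri : Triangle254 (toB6 g R H)) (hrefl : ∀ y : g.Site, g.dist y y = 0)
    (hdnn : ∀ y y' : g.Site, 0 ≤ g.dist y y') (h261 : Ineq261 d (toB6 g R H) δ₀ α)
    (hsmall : θ * B6.c1 d δ₀ α < 1) (hχN : ∀ a, ∑ i, χ i a ≤ N)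
    {G R' : Module.End ℝ (X → ℝ)} {T : ι → Module.End ℝ (X → ℝ)} {E : (X → ℝ) →ₗ[ℝ] (Z → ℝ)}
    (hfix : G = (∑ i, T i) + G * R')
    (hR : HasMajorant (g := toB6 g R H) blk R' (fun (a b : g.Site) => θ * Real.exp (-(δ₀ * g.dist a b))))
    (hlegs : ∀ i, HasMajorantHom (g := toB6 g R H) blk blkZ (E ∘ₗ T i)
      (fun (a b : g.Site) => χ i a * (A * W a * Real.exp (-(δ₀ * g.dist a b))))) :
    HasMajorantHom (g := toB6 g R H) blk blkZ (E ∘ₗ G)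
      (fun (a b : g.Site) => N * A * B6.c1 d δ₀ α * (1 - θ * B6.c1 d δ₀ α)⁻¹ * W a *
        Real.exp (-((1 - α) * δ₀ * g.dist a b))) := by
  have hαδ : 0 ≤ (1 - α) * δ₀ := mul_nonneg (by linarith) hδ₀
  have h263 : Ineq263 d (toB6 g R H) δ₀ α := ineq263_of_261 d (toB6 g R H) δ₀ α htri hδ₀ hα1 h261
  have hsumE : E ∘ₗ (∑ i, T i) = ∑ i, E ∘ₗ T i := by
    apply LinearMap.ext
    intro μ
    rw [LinearMap.comp_apply, LinearMap.sum_apply, LinearMap.sum_apply, map_sum]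
    rfl
  have hS₀ : HasMajorantHom (g := toB6 g R H) blk blkZ (E ∘ₗ ∑ i, T i)
      (fun (a b : g.Site) => N * A * W a * Real.exp (-(δ₀ * g.dist a b))) := by
    rw [hsumE]
    refine hasMajorantHom_mono (g := toB6 g R H) blk blkZ (hasMajorantHom_fintypeSum blk blkZ (fun i => E ∘ₗ T i) _ hlegs)
      fun a b => ?_
    have h1 : 0 ≤ A * W a * Real.exp (-(δ₀ * g.dist a b)) := mul_nonneg (mul_nonneg hA (hW a)) (Real.exp_nonneg _)
    calc (∑ i, χ i a * (A * W a * Real.exp (-(δ₀ * g.dist a b))))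
        = (∑ i, χ i a) * (A * W a * Real.exp (-(δ₀ * g.dist a b))) := by rw [Finset.sum_mul]
      _ ≤ N * (A * W a * Real.exp (-(δ₀ * g.dist a b))) := mul_le_mul_of_nonneg_right (hχN a) h1
      _ = N * A * W a * Real.exp (-(δ₀ * g.dist a b)) := by ring
  have hmain := hom_majorant_of_fixedPoint_266 (g := toB6 g R H) blk blkZ d δ₀ α θ (N * A) W (mul_nonneg hN hA) hW hθ hαδ
    htri hrefl hdnn h261 h263 hsmall hS₀ hR (leftEntry_fixpoint E hfix)
  exact hasMajorantHom_mono (g := toB6 g R H) blk blkZ hmain fun a b => le_of_eq (by simp only [toB6_dist])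

/-- **One convolution with a slower rate** ((2.54) + (2.61)): Σ_z e^{−δ₀d(a,z)}e^{−δ′d(z,b)} ≦ c₁(α)e^{−δ′d(a,b)} whenever
0 ≦ δ′ ≦ (1 − α)δ₀ — by the triangle inequality d(z,b) ≧ d(a,b) − d(a,z) the summand is ≦ e^{−αδ₀d(a,z)}·e^{−δ′d(a,b)}, and (2.61)
sums the first factor. [cite: Balaban1984PropagatorsII, Lemma 2.1 (2.61) p.234 + (2.54) p.233] -/
theorem conv_exp_le_of_261 (d : ℕ) (δ₀ α δ' : ℝ) (hδ' : 0 ≤ δ') (hδ'le : δ' ≤ (1 - α) * δ₀)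
    (htri : Triangle254 (toB6 g R H)) (hdnn : ∀ y y' : g.Site, 0 ≤ g.dist y y')
    (h261 : Ineq261 d (toB6 g R H) δ₀ α) (a b : g.Site) :
    ∑ z : g.Site, Real.exp (-(δ₀ * g.dist a z)) * Real.exp (-(δ' * g.dist z b)) ≤
      B6.c1 d δ₀ α * Real.exp (-(δ' * g.dist a b)) := by
  have hterm : ∀ z : g.Site, Real.exp (-(δ₀ * g.dist a z)) * Real.exp (-(δ' * g.dist z b)) ≤
      Real.exp (-(α * δ₀ * g.dist a z)) * Real.exp (-(δ' * g.dist a b)) := by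
    intro z
    rw [← Real.exp_add, ← Real.exp_add]
    apply Real.exp_le_exp.mpr
    have h1 : g.dist a b ≤ g.dist a z + g.dist z b := htri a z b
    have h2 : 0 ≤ g.dist a z := hdnn a z
    have h3 : δ' * g.dist a b ≤ δ' * (g.dist a z + g.dist z b) := mul_le_mul_of_nonneg_left h1 hδ'
    have h4 : 0 ≤ ((1 - α) * δ₀ - δ') * g.dist a z := mul_nonneg (sub_nonneg.mpr hδ'le) h2
    nlinarith [h3, h4]
  calc ∑ z : g.Site, Real.exp (-(δ₀ * g.dist a z)) * Real.exp (-(δ' * g.dist z b))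
      ≤ ∑ z : g.Site, Real.exp (-(α * δ₀ * g.dist a z)) * Real.exp (-(δ' * g.dist a b)) :=
        Finset.sum_le_sum fun z _ => hterm z
    _ = (∑ z : g.Site, Real.exp (-(α * δ₀ * g.dist a z))) * Real.exp (-(δ' * g.dist a b)) := by rw [Finset.sum_mul]
    _ ≤ B6.c1 d δ₀ α * Real.exp (-(δ' * g.dist a b)) := mul_le_mul_of_nonneg_right (h261 a) (Real.exp_nonneg _)

/-- **A MEMBER OF A LEFT FIXED POINT READ THROUGH A PROBE** (the right member of (3.43) for the sum): if T = Σ_□T₀,□ + V∘T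
(the transposed (3.105): G∇\*_U = G₀∇\*_U + R♯(G∇\*_U), `B9Thm37Glue.fixedPoint_of_388T`), T : (Y → ℝ) → (X → ℝ) has the sup
majorant C·W₁(y)e^{−δd(y,y′)} (entry 3 of `Conv3107`, W₁ = L^jη > 0), each head term read through E : (X → ℝ) → (Z → ℝ) has
the localized majorant χ_□(y)·A·W(y)e^{−δ₀d} with Σ_□χ_□ ≦ N, and E∘V has the scale-weighted majorant θ·W(y)W₁(y′)⁻¹e^{−δ₀d}
(the factors' *"additional power of L^jη"*, p. 413), then for 0 ≦ δ ≦ (1 − α)δ₀: E∘T = E∘T₀ + (E∘V)∘T has majorant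
(NA + θCc₁(α))·W(y)e^{−δd(y,y′)} — the head legs plus ONE convolution (`conv_exp_le_of_261`); no smallness is needed.
[cite: Balaban1985BackgroundPropagators, Thm 3.10 (3.105)–(3.107) pp.414–416 + p.413; Balaban1984PropagatorsII, (2.52)–(2.55) p.232 + (2.61) p.234] -/
theorem rightMember_of_localLegs [Fintype X] [Fintype Y] [Fintype Z] {ι : Type} [Fintype ι]
    (blk : X → g.Site) (blkY : Y → g.Site) (blkZ : Z → g.Site) (d : ℕ) (δ₀ α δ θ A N C : ℝ) (W W₁ : g.Site → ℝ)
    (χ : ι → g.Site → ℝ)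
    (hA : 0 ≤ A) (hN : 0 ≤ N) (hC : 0 ≤ C) (hθ : 0 ≤ θ) (hW : ∀ y, 0 ≤ W y) (hW₁ : ∀ y, 0 < W₁ y)
    (hδ : 0 ≤ δ) (hδle : δ ≤ (1 - α) * δ₀) (hαδ₀ : 0 ≤ α * δ₀)
    (htri : Triangle254 (toB6 g R H)) (hdnn : ∀ y y' : g.Site, 0 ≤ g.dist y y')
    (h261 : Ineq261 d (toB6 g R H) δ₀ α) (hχN : ∀ a, ∑ i, χ i a ≤ N)
    {T : (Y → ℝ) →ₗ[ℝ] (X → ℝ)} {T₀ : ι → (Y → ℝ) →ₗ[ℝ] (X → ℝ)} {V : Module.End ℝ (X → ℝ)}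
    {E : (X → ℝ) →ₗ[ℝ] (Z → ℝ)} (hfix : T = (∑ i, T₀ i) + V ∘ₗ T)
    (hT : HasMajorantHom (g := toB6 g R H) blkY blk T (fun (a b : g.Site) => C * W₁ a * Real.exp (-(δ * g.dist a b))))
    (hEV : HasMajorantHom (g := toB6 g R H) blk blkZ (E ∘ₗ V)
      (fun (a b : g.Site) => θ * (W a * (W₁ b)⁻¹) * Real.exp (-(δ₀ * g.dist a b))))
    (hlegs : ∀ i, HasMajorantHom (g := toB6 g R H) blkY blkZ (E ∘ₗ T₀ i)
      (fun (a b : g.Site) => χ i a * (A * W a * Real.exp (-(δ₀ * g.dist a b))))) :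
    HasMajorantHom (g := toB6 g R H) blkY blkZ (E ∘ₗ T)
      (fun (a b : g.Site) => (N * A + θ * C * B6.c1 d δ₀ α) * W a * Real.exp (-(δ * g.dist a b))) := by
  have hδδ₀ : δ ≤ δ₀ := by nlinarith [hδle, hαδ₀]
  have hexp : ∀ a b : g.Site, Real.exp (-(δ₀ * g.dist a b)) ≤ Real.exp (-(δ * g.dist a b)) := fun a b =>
    Real.exp_le_exp.mpr (neg_le_neg (mul_le_mul_of_nonneg_right hδδ₀ (hdnn a b)))
  -- E∘T = E∘T₀ + (E∘V)∘T
  have heq : E ∘ₗ T = (∑ i, E ∘ₗ T₀ i) + (E ∘ₗ V) ∘ₗ T := by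
    have hsum : E ∘ₗ (∑ i, T₀ i) = ∑ i, E ∘ₗ T₀ i := by
      apply LinearMap.ext
      intro μ
      rw [LinearMap.comp_apply, LinearMap.sum_apply, LinearMap.sum_apply, map_sum]
      rfl
    conv_lhs => rw [hfix]
    rw [LinearMap.comp_add, hsum, LinearMap.comp_assoc]
  -- the head terms
  have h₀ : HasMajorantHom (g := toB6 g R H) blkY blkZ (∑ i, E ∘ₗ T₀ i)
      (fun (a b : g.Site) => (∑ i, χ i a) * (A * W a * Real.exp (-(δ₀ * g.dist a b)))) := by
    refine hasMajorantHom_mono (g := toB6 g R H) blkY blkZ (hasMajorantHom_fintypeSum blkY blkZ (fun i => E ∘ₗ T₀ i) _ hlegs)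
      fun a b => le_of_eq ?_
    rw [Finset.sum_mul]
  -- (E∘V)∘T: one convolution
  have hK₂ : ∀ a b : g.Site, 0 ≤ C * W₁ a * Real.exp (-(δ * g.dist a b)) := fun a b =>
    mul_nonneg (mul_nonneg hC (hW₁ a).le) (Real.exp_nonneg _)
  have h₁ := hasMajorantHom_comp (g := toB6 g R H) blkY blk blkZ hEV hT hK₂
  have h₁' : HasMajorantHom (g := toB6 g R H) blkY blkZ ((E ∘ₗ V) ∘ₗ T)
      (fun (a b : g.Site) => θ * C * B6.c1 d δ₀ α * W a * Real.exp (-(δ * g.dist a b))) := by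
    refine hasMajorantHom_mono (g := toB6 g R H) blkY blkZ h₁ fun a b => ?_
    have hW₁ne : ∀ z : g.Site, W₁ z ≠ 0 := fun z => (hW₁ z).ne'
    have hrw : ∀ z : g.Site, θ * (W a * (W₁ z)⁻¹) * Real.exp (-(δ₀ * g.dist a z)) *
        (C * W₁ z * Real.exp (-(δ * g.dist z b)))
        = θ * C * W a * (Real.exp (-(δ₀ * g.dist a z)) * Real.exp (-(δ * g.dist z b))) := by
      intro z
      have hz : (W₁ z)⁻¹ * W₁ z = 1 := inv_mul_cancel₀ (hW₁ne z)
      calc θ * (W a * (W₁ z)⁻¹) * Real.exp (-(δ₀ * g.dist a z)) * (C * W₁ z * Real.exp (-(δ * g.dist z b)))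
          = θ * C * W a * ((W₁ z)⁻¹ * W₁ z) * (Real.exp (-(δ₀ * g.dist a z)) * Real.exp (-(δ * g.dist z b))) := by
            ring
        _ = θ * C * W a * (Real.exp (-(δ₀ * g.dist a z)) * Real.exp (-(δ * g.dist z b))) := by rw [hz, mul_one]
    calc (∑ z : g.Site, θ * (W a * (W₁ z)⁻¹) * Real.exp (-(δ₀ * (toB6 g R H).dist a z)) *
            (C * W₁ z * Real.exp (-(δ * (toB6 g R H).dist z b))))
        = θ * C * W a * ∑ z : g.Site, Real.exp (-(δ₀ * g.dist a z)) * Real.exp (-(δ * g.dist z b)) := by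
          simp only [toB6_dist]
          rw [Finset.mul_sum]
          exact Finset.sum_congr rfl fun z _ => hrw z
      _ ≤ θ * C * W a * (B6.c1 d δ₀ α * Real.exp (-(δ * g.dist a b))) :=
          mul_le_mul_of_nonneg_left (conv_exp_le_of_261 d δ₀ α δ hδ hδle htri hdnn h261 a b)
            (mul_nonneg (mul_nonneg hθ hC) (hW a))
      _ = θ * C * B6.c1 d δ₀ α * W a * Real.exp (-(δ * g.dist a b)) := by ring
  rw [heq]
  refine hasMajorantHom_mono (g := toB6 g R H) blkY blkZ (hasMajorantHom_add (g := toB6 g R H) blkY blkZ h₀ h₁')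
    fun a b => ?_
  have hAW : 0 ≤ A * W a := mul_nonneg hA (hW a)
  have hsum_le : (∑ i, χ i a) * (A * W a * Real.exp (-(δ₀ * g.dist a b))) ≤
      N * (A * W a * Real.exp (-(δ * g.dist a b))) :=
    calc (∑ i, χ i a) * (A * W a * Real.exp (-(δ₀ * g.dist a b)))
        ≤ N * (A * W a * Real.exp (-(δ₀ * g.dist a b))) :=
          mul_le_mul_of_nonneg_right (hχN a) (mul_nonneg hAW (Real.exp_nonneg _))
      _ ≤ N * (A * W a * Real.exp (-(δ * g.dist a b))) :=
          mul_le_mul_of_nonneg_left (mul_le_mul_of_nonneg_left (hexp a b) hAW) hN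
  calc (∑ i, χ i a) * (A * W a * Real.exp (-(δ₀ * g.dist a b))) +
        θ * C * B6.c1 d δ₀ α * W a * Real.exp (-(δ * g.dist a b))
      ≤ N * (A * W a * Real.exp (-(δ * g.dist a b))) + θ * C * B6.c1 d δ₀ α * W a * Real.exp (-(δ * g.dist a b)) :=
        add_le_add hsum_le le_rfl
    _ = (N * A + θ * C * B6.c1 d δ₀ α) * W a * Real.exp (-(δ * g.dist a b)) := by ring

end Engines

/-! ## §2 Probe lattices: the letters, the co-reading of `K.h1`, and the (3.43) line from two probe majorants -/

section Readings

variable {g : B9.Geometry} [Fintype g.Site] {R : ℝ} {H : Prop} {B : B9.Backgrounds} {X Y PX PY : Type}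

/-- **THE PROBE LETTERS OF (3.40) ∕ (3.43) AT ONE MEMBER** — a PARAMETER RECORD (nothing constructed or asserted).  For each
configuration U and exponent β, the transported Hölder difference quotients of (3.40) with a cut-off ζ ∈ C₀^∞(Δ̃(y)),
f ↦ |x′ − x|^{−β}(ζ(x′)R(U(Γ_{x,x′}))f(x′) − ζ(x)f(x)) (and their normalisations by ‖ζ‖^ξ_β + |ζ|; r06's `holderQuot340_apply`),
are ℝ-LINEAR FUNCTIONALS of the output; `ΦX U β` collects a finite family of them on the X-functions (the quotients of ζG∇\*_UJ)
into the PROBE LATTICE `PX` with anchors `blkPX` (the y of ζ ∈ C₀^∞(Δ̃(y))), `ΦY U β` the same on the Y-functions (the quotients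
of ζ∇_UGJ) into `PY`.  Which functionals realise the printed sup is the instance's business (n06-b `hasMaj_probe_iff`).
[cite: Balaban1985BackgroundPropagators, (3.40) p.397 + (3.43) p.398] -/
structure HolderProbes (g : B9.Geometry) (B : B9.Backgrounds) (X Y PX PY : Type) where
  blkPX : PX → g.Site
  blkPY : PY → g.Site
  ΦX : B.Cfg → ℝ → ((X → ℝ) →ₗ[ℝ] (PX → ℝ))
  ΦY : B.Cfg → ℝ → ((Y → ℝ) →ₗ[ℝ] (PY → ℝ))

/-- **CO-READING OF THE HÖLDER QUANTITY `K.h1` OF A KERNEL FAMILY BY TWO MODEL OPERATORS THROUGH THE PROBES** (companion of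
n06-c's `B9Thm37GlueCor36.CoRealizes` for the sup entries and of `GlobReads` ∕ `L2Reads`).  Print, (3.43) p. 398: the left
member is the max of ‖ζ∇_UGλ‖_β and ‖ζG∇\*_Uλ‖_β against (‖ζ‖^ξ_β + |ζ|)·(…)·|λ| (`B9.KernelFamily.h1`: *"(max of the two)"*).
Typed: the argument λ evaluates on the lattices X (`ev`, input of T_L = ∇_UG) and Y (`evY`, input of T_R = G∇\*_U) with
supp λ ⊂ Δ(y′) ⇒ the evaluations vanish off the block of y′ and |ev λ|, |evY λ| ≦ |λ| (`off`, `bound`, …); and (`obs`) for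
ζ ∈ C₀^∞(Δ̃(y)): h1(U, λ, β, ζ) ≦ c·(‖ζ‖^ξ_β + |ζ|) whenever every probe anchored at y is ≦ c on T_L(ev λ) and on T_R(evY λ).
A HYPOTHESIS SCHEMA on how a model instantiates `h1` ∕ `cutH`; nothing asserted.
[cite: Balaban1985BackgroundPropagators, (3.43) p.398 + (3.40) p.397] -/
structure H1Reads (K : B9.KernelFamily g B) (U : B.Cfg) (𝔭 : HolderProbes g B X Y PX PY) (blk : X → g.Site)
    (blkY : Y → g.Site) (ev : g.Loc → X → ℝ) (evY : g.Loc → Y → ℝ) (TL : (X → ℝ) →ₗ[ℝ] (Y → ℝ))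
    (TR : (Y → ℝ) →ₗ[ℝ] (X → ℝ)) : Prop where
  off : ∀ (lam : g.Loc) (y' : g.Site), g.suppIn lam y' → ∀ x, blk x ≠ y' → ev lam x = 0
  bound : ∀ (lam : g.Loc) (x : X), |ev lam x| ≤ g.supNorm lam
  offY : ∀ (lam : g.Loc) (y' : g.Site), g.suppIn lam y' → ∀ v, blkY v ≠ y' → evY lam v = 0
  boundY : ∀ (lam : g.Loc) (v : Y), |evY lam v| ≤ g.supNorm lam
  norm_nonneg : ∀ lam : g.Loc, 0 ≤ g.supNorm lam
  cutH_nonneg : ∀ (β : ℝ) (ζ : g.Cut), 0 ≤ g.cutH β ζ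
  obs : ∀ (lam : g.Loc) (β : ℝ) (ζ : g.Cut) (y : g.Site) (c : ℝ), 0 ≤ c → g.cutInT ζ y →
    (∀ p : PY, 𝔭.blkPY p = y → |𝔭.ΦY U β (TL (ev lam)) p| ≤ c) →
    (∀ p : PX, 𝔭.blkPX p = y → |𝔭.ΦX U β (TR (evY lam)) p| ≤ c) →
    K.h1 U lam β ζ ≤ c * g.cutH β ζ

/-- **TWO PROBE MAJORANTS OF THE PRINTED SHAPE ⇒ THE (3.43) LINE AS TYPED** (the first conjunct of `B9.Ineq343_345`): if for
every 0 ≦ β < 1 the model operators read through the probes, Φ^Y_β(U)∘T_L (X-functions → probe lattice P_Y) and Φ^X_β(U)∘T_R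
(Y-functions → P_X), have the two-space sup majorants B(β)(L^jη)^{1−β}e^{−δ₀d(y,y′)} with B(β) ≧ 0, and `K.h1` is co-read by
(T_L, T_R) through the probes, then ∀ β λ ζ y y′ (0 ≦ β < 1, ζ ∈ C₀^∞(Δ̃(y)), supp λ ⊂ Δ(y′)): h1(U, λ, β, ζ) ≦
B(β)(L^jη)^{1−β}(‖ζ‖^ξ_β + |ζ|)e^{−δ₀d(y,y′)}|λ|. [cite: Balaban1985BackgroundPropagators, (3.43) p.398] -/
theorem line343_of_hasMajorantHom {K : B9.KernelFamily g B} {U : B.Cfg} {𝔭 : HolderProbes g B X Y PX PY}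
    {blk : X → g.Site} {blkY : Y → g.Site} {ev : g.Loc → X → ℝ} {evY : g.Loc → Y → ℝ}
    {TL : (X → ℝ) →ₗ[ℝ] (Y → ℝ)} {TR : (Y → ℝ) →ₗ[ℝ] (X → ℝ)}
    (hR : H1Reads K U 𝔭 blk blkY ev evY TL TR) {Bβ : ℝ → ℝ} {δ₀ : ℝ} (hB : ∀ β, 0 ≤ β → β < 1 → 0 ≤ Bβ β)
    (hlen : ∀ y : g.Site, 0 ≤ g.len y)
    (hL : ∀ β, 0 ≤ β → β < 1 → HasMajorantHom (g := toB6 g R H) blk 𝔭.blkPY (𝔭.ΦY U β ∘ₗ TL)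
      (fun (a b : g.Site) => Bβ β * g.len a ^ (1 - β) * Real.exp (-(δ₀ * g.dist a b))))
    (hRt : ∀ β, 0 ≤ β → β < 1 → HasMajorantHom (g := toB6 g R H) blkY 𝔭.blkPX (𝔭.ΦX U β ∘ₗ TR)
      (fun (a b : g.Site) => Bβ β * g.len a ^ (1 - β) * Real.exp (-(δ₀ * g.dist a b)))) :
    ∀ (β : ℝ) (lam : g.Loc) (ζ : g.Cut) (y y' : g.Site), 0 ≤ β → β < 1 → g.cutInT ζ y → g.suppIn lam y' →
      K.h1 U lam β ζ ≤ Bβ β * (g.len y) ^ (1 - β) * g.cutH β ζ * Real.exp (-(δ₀ * g.dist y y')) *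
        g.supNorm lam := by
  intro β lam ζ y y' hβ0 hβ1 hζ hs
  have hc : 0 ≤ Bβ β * g.len y ^ (1 - β) * Real.exp (-(δ₀ * g.dist y y')) * g.supNorm lam :=
    mul_nonneg (mul_nonneg (mul_nonneg (hB β hβ0 hβ1) (Real.rpow_nonneg (hlen y) _)) (Real.exp_nonneg _))
      (hR.norm_nonneg lam)
  have hμ : BlockSupp (g := toB6 g R H) blk (ev lam) y' (g.supNorm lam) :=
    ⟨hR.norm_nonneg lam, fun x _ => hR.bound lam x, hR.off lam y' hs⟩
  have hμY : BlockSupp (g := toB6 g R H) blkY (evY lam) y' (g.supNorm lam) :=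
    ⟨hR.norm_nonneg lam, fun v _ => hR.boundY lam v, hR.offY lam y' hs⟩
  have hobs := hR.obs lam β ζ y _ hc hζ
    (fun p hp => by
      have hb := hL β hβ0 hβ1 y' (ev lam) (g.supNorm lam) hμ p
      rw [hp] at hb
      exact hb)
    (fun p hp => by
      have hb := hRt β hβ0 hβ1 y' (evY lam) (g.supNorm lam) hμY p
      rw [hp] at hb
      exact hb)
  exact hobs.trans (le_of_eq (by ring))

omit [Fintype g.Site] in
/-- The verbatim Hölder block `B9.Ineq343_345 K Bβ Bε Bεβ δ₀ U` from its three lines (bookkeeping, `Iff.rfl`-level): the (3.43)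
line (here PROVED from probe majorants) and the (3.44), (3.45) lines (displayed by the consumer).
[cite: Balaban1985BackgroundPropagators, (3.43)–(3.45) p.398] -/
theorem ineq343_345_of_lines {K : B9.KernelFamily g B} {Bβ Bε : ℝ → ℝ} {Bεβ : ℝ → ℝ → ℝ} {δ₀ : ℝ} {U : B.Cfg}
    (h343 : ∀ (β : ℝ) (lam : g.Loc) (ζ : g.Cut) (y y' : g.Site), 0 ≤ β → β < 1 → g.cutInT ζ y → g.suppIn lam y' →
      K.h1 U lam β ζ ≤ Bβ β * (g.len y) ^ (1 - β) * g.cutH β ζ * Real.exp (-(δ₀ * g.dist y y')) * g.supNorm lam)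
    (h344 : ∀ (ε : ℝ) (lam : g.Loc) (y y' : g.Site), 0 < ε → ε ≤ 1 → g.suppInT lam y' →
      K.e4 U lam y ≤ Bε ε * Real.exp (-(δ₀ * g.dist y y')) * (g.holder ε lam + g.supNorm lam))
    (h345 : ∀ (ε β : ℝ) (lam : g.Loc) (ζ : g.Cut) (y y' : g.Site), 0 < ε → ε ≤ 1 → 0 ≤ β → β < 1 →
      g.cutInT ζ y → g.suppInT lam y' →
      K.h2 U lam β ζ ≤ Bεβ ε β * (g.len y) ^ (-β) * g.cutH β ζ * Real.exp (-(δ₀ * g.dist y y')) *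
        (g.holder (β + ε) lam + g.supNorm lam)) :
    B9.Ineq343_345 K Bβ Bε Bεβ δ₀ U :=
  ⟨h343, h344, h345⟩

end Readings

/-! ## §3 The sum G(U) of (3.107): the Hölder legs of the head terms, the transposed factors through the probes, the member
(3.43) at one member and one U, and the leaf at the all-blocks pin with (3.43) proved -/

section GSide

variable {g : B9.Geometry} [Fintype g.Site] [DecidableEq g.Site] {R : ℝ} {H : Prop} {B : B9.Backgrounds}
variable {X Y ι A PX PY : Type}

/-- **COROLLARY 3.6's (3.43) FOR THE HEAD TERMS h_□G_□(U)h_□ OF (3.107), READ THROUGH THE PROBES, LOCALIZED** (p. 409: *"The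
operators G_□(U) … satisfy all the inequalities of Theorems 3.1–3.3 correspondingly"*; (3.43) p. 398 with Theorem 3.3's
reading G′ ↦ G, λ ↦ J): for 0 ≦ β < 1 and every □, the left member Φ^Y_β(U)∘∇_U∘(h_□G_□h_□) and the right member
Φ^X_β(U)∘(h_□G_□h_□)∘∇\*_U have the two-space sup majorants 1_{S_H(□)}(y)·B_ℓ(β)(L^jη)^{1−β}e^{−δ₀d(y,y′)}, S_H(□) = the blocks
whose enlarged cube Δ̃(y) meets supp h_□ (the probes anchored elsewhere vanish on the term).  POSITED AS A WHOLE — in print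
this is (3.43) for G_□ together with the product rule of the quotient (3.40) through h_□ and the sizes ∂h_□ = O((ML^jη)⁻¹)
((3.100) p. 413), neither displayed (cell GAPS G-pv21g4-1 (i)); exactly the legs `hleg` of `B9Thm37AllNorms.thm37_left`.
A HYPOTHESIS SCHEMA; Corollary 3.6 is not asserted. [cite: Balaban1985BackgroundPropagators, Cor. 3.6 p.408 + p.409 + (3.43) p.398 + (3.100) p.413] -/
structure HolderLegs310 (𝔬 : Ops310 g B X Y ι A) (𝔭 : HolderProbes g B X Y PX PY) (R : ℝ) (H : Prop)
    (SH : ι → Finset g.Site) (Bl : ℝ → ℝ) (δ₀ : ℝ) (U : B.Cfg) : Prop where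
  left : ∀ β : ℝ, 0 ≤ β → β < 1 → ∀ i, HasMajorantHom (g := toB6 g R H) 𝔬.blk 𝔭.blkPY
    ((𝔭.ΦY U β ∘ₗ 𝔬.D U) ∘ₗ (mulOp (𝔬.h i) * 𝔬.Gsq U i * mulOp (𝔬.h i)))
    (fun (a b : g.Site) => (if a ∈ SH i then (1 : ℝ) else 0) *
      (Bl β * g.len a ^ (1 - β) * Real.exp (-(δ₀ * g.dist a b))))
  right : ∀ β : ℝ, 0 ≤ β → β < 1 → ∀ i, HasMajorantHom (g := toB6 g R H) 𝔬.blkY 𝔭.blkPX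
    (𝔭.ΦX U β ∘ₗ ((mulOp (𝔬.h i) * 𝔬.Gsq U i * mulOp (𝔬.h i)) ∘ₗ 𝔬.Dstar U))
    (fun (a b : g.Site) => (if a ∈ SH i then (1 : ℝ) else 0) *
      (Bl β * g.len a ^ (1 - β) * Real.exp (-(δ₀ * g.dist a b))))

/-- **THE TRANSPOSED FACTORS R♯_a(U) OF (3.105) READ THROUGH THE PROBES Φ^X_β(U)** (p. 413: *"An operator R_α(X) … is localized
in X, … and satisfies a bound of the type (3.89), possibly with an additional power of L^jη"*; p. 416: the terms of (3.107)
satisfy *"(3.108) and the corresponding inequalities for norms on the left-hand sides of (3.42)–(3.47)"*): for 0 ≦ β < 1, Φ^X_β∘R♯_a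
has the scale-weighted majorant 1_{X∩𝔅}(y′)·θ_H(β)M⁻¹·(L^jη)^{1−β}(L^{j′}η)⁻¹·e^{−δ₀d(y,y′)} — the Hölder-probe companion of
`B9Thm310Whole.Factors389.facT` (the Hölder quotient at scale costing (L^jη)^{−β}).  POSITED; the smallness analysis of the pieces
of R (cell GAPS G-B9-05∕06a∕07) is not reproduced. [cite: Balaban1985BackgroundPropagators, p.413 + (3.105) p.414 + Thm 3.10 p.416 + (3.89) p.409] -/
structure FactorsHolder310 (𝔬 : Ops310 g B X Y ι A) (𝔭 : HolderProbes g B X Y PX PY) (R : ℝ) (H : Prop)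
    (θH : ℝ → ℝ) (δ₀ : ℝ) (U : B.Cfg) : Prop where
  facT : ∀ β : ℝ, 0 ≤ β → β < 1 → ∀ a : A, HasMajorantHom (g := toB6 g R H) 𝔬.blk 𝔭.blkPX (𝔭.ΦX U β ∘ₗ 𝔬.Rt U a)
    (fun (y y' : g.Site) => (if y' ∈ 𝔬.SF a then (1 : ℝ) else 0) * (θH β * g.M⁻¹) *
      (g.len y ^ (1 - β) * (g.len y')⁻¹) * Real.exp (-(δ₀ * g.dist y y')))

/-- **The constant of the (3.43) member of the sum** at the exponent β: 2N_H·B_ℓ(β)·c₁(α) (left member: the head legs summed with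
the overlap count N_H, the Neumann factor (1 − N_Fθ₀M⁻¹c₁)⁻¹ ≦ 2 of «M sufficiently large») + N_H·B_ℓ(β) + N_F·θ_H(β)·C·c₁(α)
(right member: head legs plus the transposed factors against the entry-3 constant C of the sum).
[cite: Balaban1985BackgroundPropagators, Thm 3.10 p.416 + (3.43) p.398; Balaban1984PropagatorsII, Lemma 2.1 (2.61) p.234] -/
def holderConst (d : ℕ) (δ₀ α NH NF C b t : ℝ) : ℝ :=
  2 * NH * b * B6.c1 d δ₀ α + (NH * b + NF * t * C * B6.c1 d δ₀ α)

omit [Fintype g.Site] [DecidableEq g.Site] in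
/-- The constant is ≧ 0 for nonnegative letters. [folklore] -/
private theorem holderConst_nonneg {d : ℕ} {δ₀ α NH NF C b t : ℝ} (hNH : 0 ≤ NH) (hNF : 0 ≤ NF) (hC : 0 ≤ C) (hb : 0 ≤ b)
    (ht : 0 ≤ t) : 0 ≤ holderConst d δ₀ α NH NF C b t := by
  have hc1 : 0 ≤ B6.c1 d δ₀ α := c1_nonneg d δ₀ α
  unfold holderConst
  positivity

/-- **THE MEMBER (3.43) OF THE SUM G(U) OF (3.107) AT ONE MEMBER AND ONE CONFIGURATION U — both probe majorants.**  LEFT: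
Φ^Y_β∘∇_U∘G = Φ^Y_β∘∇_U∘G₀ + (Φ^Y_β∘∇_U∘G)∘R from G = G₀ + GR ((3.106), `B9Thm37Sum.fixedPoint_of_388` on GΔ_a = I and (3.105)),
the Hölder legs summed with the overlap count N_H, the factors' sup majorant N_Fθ₀M⁻¹e^{−δ₀d} (`Factors389.fac`) and
`leftMember_of_localLegs`; RIGHT: Φ^X_β∘(G∘∇\*_U) = Φ^X_β∘(G₀∘∇\*_U) + (Φ^X_β∘ΣR♯_a)∘(G∘∇\*_U) from the transposed (3.105)
(`B9Thm37Glue.fixedPoint_of_388T`), the right legs, the probe bounds of the transposed factors (`FactorsHolder310`), the entry-3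
sup majorant C·L^jη·e^{−δd} of the sum (`Conv3107`, third conjunct) and `rightMember_of_localLegs`.  For 0 ≦ δ ≦ (1 − α)δ₀,
M ≧ 1 and the located smallness N_Fθ₀M⁻¹c₁(α) ≦ ½, BOTH members have the majorant `holderConst …`(β)·(L^jη)^{1−β}e^{−δd(y,y′)}.
[cite: Balaban1985BackgroundPropagators, Thm 3.10 (3.105)–(3.108) pp.414–416 + (3.43) p.398 + p.413; Balaban1984PropagatorsII, Prop 2.2 (2.66) p.234] -/
theorem holder343_of_local310 [Fintype X] [DecidableEq X] [Fintype Y] [DecidableEq Y] [Fintype ι] [Fintype A]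
    [Fintype PX] [DecidableEq PX] [Fintype PY] [DecidableEq PY]
    (𝔬 : Ops310 g B X Y ι A) (𝔭 : HolderProbes g B X Y PX PY) (R : ℝ) (H : Prop) (d : ℕ)
    (δ₀ α ρ N N' NF Cℓ θ₀ NH C δ : ℝ) (κ : Sizes310) (SH : ι → Finset g.Site) (Bl θH : ℝ → ℝ) (U : B.Cfg)
    (hδ₀ : 0 ≤ δ₀) (hα : 0 ≤ α) (hα1 : α ≤ 1) (hNF : 0 ≤ NF) (hθ₀ : 0 ≤ θ₀) (hNH : 0 ≤ NH) (hM : 1 ≤ g.M)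
    (hC : 0 ≤ C) (hδ : 0 ≤ δ) (hδle : δ ≤ (1 - α) * δ₀)
    (hs : StaticOK310 𝔬 ρ N N' NF Cℓ κ) (hcntH : ∀ a : g.Site, (∑ i, if a ∈ SH i then (1 : ℝ) else 0) ≤ NH)
    (hBl : ∀ β, 0 ≤ β → β < 1 → 0 ≤ Bl β) (hθH : ∀ β, 0 ≤ β → β < 1 → 0 ≤ θH β)
    (h261 : Ineq261 d (toB6 g R H) δ₀ α) (hq : NF * (θ₀ * g.M⁻¹) * B6.c1 d δ₀ α ≤ 1 / 2)
    (hf : Factors389 𝔬 R H θ₀ δ₀ U) (hi : Identities310 𝔬 R H U)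
    (hL : HolderLegs310 𝔬 𝔭 R H SH Bl δ₀ U) (hF : FactorsHolder310 𝔬 𝔭 R H θH δ₀ U)
    (h2 : HasMajorantHom (g := toB6 g R H) 𝔬.blkY 𝔬.blk (𝔬.G U ∘ₗ 𝔬.Dstar U)
      (fun (a b : g.Site) => C * g.len a * Real.exp (-(δ * g.dist a b)))) :
    ∀ β : ℝ, 0 ≤ β → β < 1 →
      HasMajorantHom (g := toB6 g R H) 𝔬.blk 𝔭.blkPY ((𝔭.ΦY U β ∘ₗ 𝔬.D U) ∘ₗ 𝔬.G U)
          (fun (a b : g.Site) => holderConst d δ₀ α NH NF C (Bl β) (θH β) * g.len a ^ (1 - β) *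
            Real.exp (-(δ * g.dist a b))) ∧
        HasMajorantHom (g := toB6 g R H) 𝔬.blkY 𝔭.blkPX (𝔭.ΦX U β ∘ₗ (𝔬.G U ∘ₗ 𝔬.Dstar U))
          (fun (a b : g.Site) => holderConst d δ₀ α NH NF C (Bl β) (θH β) * g.len a ^ (1 - β) *
            Real.exp (-(δ * g.dist a b))) := by
  intro β hβ0 hβ1
  have hMpos : 0 < g.M := lt_of_lt_of_le one_pos hM
  have hMinv : g.M⁻¹ ≤ 1 := inv_le_one_of_one_le₀ hM
  have hMinv0 : 0 ≤ g.M⁻¹ := inv_nonneg.mpr hMpos.le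
  have hlen : ∀ y : g.Site, 0 ≤ g.len y := fun y => (hs.lenpos y).le
  have hW : ∀ y : g.Site, 0 ≤ g.len y ^ (1 - β) := fun y => Real.rpow_nonneg (hlen y) _
  have htri : Triangle254 (toB6 g R H) := fun a b c => hs.tri a b c
  have hc1 : 0 ≤ B6.c1 d δ₀ α := c1_nonneg d δ₀ α
  have hθM : 0 ≤ θ₀ * g.M⁻¹ := mul_nonneg hθ₀ hMinv0
  have hθ : 0 ≤ NF * (θ₀ * g.M⁻¹) := mul_nonneg hNF hθM
  have hsmall : NF * (θ₀ * g.M⁻¹) * B6.c1 d δ₀ α < 1 := by linarith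
  have hb : 0 ≤ Bl β := hBl β hβ0 hβ1
  have ht : 0 ≤ θH β := hθH β hβ0 hβ1
  have hαδ₀ : 0 ≤ α * δ₀ := mul_nonneg hα hδ₀
  have hexp : ∀ a b : g.Site, Real.exp (-((1 - α) * δ₀ * g.dist a b)) ≤ Real.exp (-(δ * g.dist a b)) := fun a b =>
    Real.exp_le_exp.mpr (neg_le_neg (mul_le_mul_of_nonneg_right hδle (hs.dnn a b)))
  -- R = Σ_a R_a has majorant N_F·θ₀M⁻¹·e^{−δ₀d}
  have hRa : ∀ a : A, HasMajorant (g := toB6 g R H) 𝔬.blk (𝔬.Rf U a)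
      (fun (y y' : g.Site) => (if y ∈ 𝔬.SF a then (1 : ℝ) else 0) * (θ₀ * g.M⁻¹ * Real.exp (-(δ₀ * g.dist y y')))) :=
    fun a => hasMajorant_mono (g := toB6 g R H) 𝔬.blk (hf.fac a) fun y y' => le_of_eq (by split_ifs <;> simp)
  have hR : HasMajorant (g := toB6 g R H) 𝔬.blk (∑ a, 𝔬.Rf U a)
      (fun (y y' : g.Site) => NF * (θ₀ * g.M⁻¹) * Real.exp (-(δ₀ * g.dist y y'))) := by
    have hloc := hasMajorant_localSum (G := toB6 g R H) 𝔬.blk (fun a => 𝔬.Rf U a)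
      (fun a (y : g.Site) => if y ∈ 𝔬.SF a then (1 : ℝ) else 0)
      (fun (y y' : g.Site) => θ₀ * g.M⁻¹ * Real.exp (-(δ₀ * g.dist y y'))) NF
      (fun y y' => mul_nonneg hθM (Real.exp_nonneg _)) hRa hs.cntF
    exact hasMajorant_mono (g := toB6 g R H) 𝔬.blk hloc fun y y' => le_of_eq (by ring)
  -- (3.106): G = G₀ + GR
  have hfix : 𝔬.G U = (∑ i, mulOp (𝔬.h i) * 𝔬.Gsq U i * mulOp (𝔬.h i)) + 𝔬.G U * ∑ a, 𝔬.Rf U a :=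
    fixedPoint_of_388 hi.inv hi.eq3105
  -- LEFT member
  have eL := leftMember_of_localLegs (R := R) (H := H) 𝔬.blk 𝔭.blkPY d δ₀ α (NF * (θ₀ * g.M⁻¹)) (Bl β) NH
    (fun y => g.len y ^ (1 - β)) (fun i (a : g.Site) => if a ∈ SH i then (1 : ℝ) else 0) hb hNH hW hθ hδ₀ hα1 htri
    hs.refl hs.dnn h261 hsmall hcntH hfix hR (hL.left β hβ0 hβ1)
  -- RIGHT member: the transposed (3.105)
  have hGT : 𝔬.G U = (∑ i, mulOp (𝔬.h i) * 𝔬.Gsq U i * mulOp (𝔬.h i)) + (∑ a, 𝔬.Rt U a) * 𝔬.G U :=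
    fixedPoint_of_388T hi.invT hi.eq3105T
  have hsumD : (∑ i, mulOp (𝔬.h i) * 𝔬.Gsq U i * mulOp (𝔬.h i)) ∘ₗ 𝔬.Dstar U =
      ∑ i, (mulOp (𝔬.h i) * 𝔬.Gsq U i * mulOp (𝔬.h i)) ∘ₗ 𝔬.Dstar U := by
    apply LinearMap.ext
    intro μ
    simp only [LinearMap.comp_apply, LinearMap.sum_apply]
  have hfixT : 𝔬.G U ∘ₗ 𝔬.Dstar U = (∑ i, (mulOp (𝔬.h i) * 𝔬.Gsq U i * mulOp (𝔬.h i)) ∘ₗ 𝔬.Dstar U) +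
      (∑ a, 𝔬.Rt U a) ∘ₗ (𝔬.G U ∘ₗ 𝔬.Dstar U) := by
    conv_lhs => rw [hGT]
    rw [LinearMap.add_comp, Module.End.mul_eq_comp, LinearMap.comp_assoc, hsumD]
  -- Φ^X∘ΣR♯_a: the probe bounds of the transposed factors summed with N_F
  have hsumV : 𝔭.ΦX U β ∘ₗ (∑ a, 𝔬.Rt U a) = ∑ a, 𝔭.ΦX U β ∘ₗ 𝔬.Rt U a := by
    apply LinearMap.ext
    intro μ
    rw [LinearMap.comp_apply, LinearMap.sum_apply, LinearMap.sum_apply, map_sum]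
    rfl
  have hEV : HasMajorantHom (g := toB6 g R H) 𝔬.blk 𝔭.blkPX (𝔭.ΦX U β ∘ₗ ∑ a, 𝔬.Rt U a)
      (fun (y y' : g.Site) => NF * (θH β * g.M⁻¹) * (g.len y ^ (1 - β) * (g.len y')⁻¹) *
        Real.exp (-(δ₀ * g.dist y y'))) := by
    rw [hsumV]
    refine hasMajorantHom_mono (g := toB6 g R H) 𝔬.blk 𝔭.blkPX
      (hasMajorantHom_fintypeSum 𝔬.blk 𝔭.blkPX (fun a => 𝔭.ΦX U β ∘ₗ 𝔬.Rt U a) _ (hF.facT β hβ0 hβ1)) fun y y' => ?_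
    have h3 : 0 ≤ (θH β * g.M⁻¹) * (g.len y ^ (1 - β) * (g.len y')⁻¹) * Real.exp (-(δ₀ * g.dist y y')) :=
      mul_nonneg (mul_nonneg (mul_nonneg ht hMinv0) (mul_nonneg (hW y) (inv_nonneg.mpr (hlen y')))) (Real.exp_nonneg _)
    calc (∑ a, (if y' ∈ 𝔬.SF a then (1 : ℝ) else 0) * (θH β * g.M⁻¹) * (g.len y ^ (1 - β) * (g.len y')⁻¹) *
            Real.exp (-(δ₀ * g.dist y y')))
        = (∑ a, if y' ∈ 𝔬.SF a then (1 : ℝ) else 0) *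
            ((θH β * g.M⁻¹) * (g.len y ^ (1 - β) * (g.len y')⁻¹) * Real.exp (-(δ₀ * g.dist y y'))) := by
          rw [Finset.sum_mul]
          exact Finset.sum_congr rfl fun a _ => by ring
      _ ≤ NF * ((θH β * g.M⁻¹) * (g.len y ^ (1 - β) * (g.len y')⁻¹) * Real.exp (-(δ₀ * g.dist y y'))) :=
          mul_le_mul_of_nonneg_right (hs.cntF y') h3
      _ = NF * (θH β * g.M⁻¹) * (g.len y ^ (1 - β) * (g.len y')⁻¹) * Real.exp (-(δ₀ * g.dist y y')) := by ring
  have eR := rightMember_of_localLegs (R := R) (H := H) 𝔬.blk 𝔬.blkY 𝔭.blkPX d δ₀ α δ (NF * (θH β * g.M⁻¹)) (Bl β) NH C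
    (fun y => g.len y ^ (1 - β)) (fun y => g.len y) (fun i (a : g.Site) => if a ∈ SH i then (1 : ℝ) else 0) hb hNH hC
    (mul_nonneg hNF (mul_nonneg ht hMinv0)) hW hs.lenpos hδ hδle hαδ₀ htri hs.dnn h261 hcntH hfixT h2 hEV
    (hL.right β hβ0 hβ1)
  -- the two constants against `holderConst`
  have hK : 0 ≤ holderConst d δ₀ α NH NF C (Bl β) (θH β) := holderConst_nonneg hNH hNF hC hb ht
  refine ⟨hasMajorantHom_mono (g := toB6 g R H) 𝔬.blk 𝔭.blkPY eL fun a b => ?_,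
    hasMajorantHom_mono (g := toB6 g R H) 𝔬.blkY 𝔭.blkPX eR fun a b => ?_⟩
  · -- NH·Bl·c₁(1 − q)⁻¹ ≤ 2NH·Bl·c₁ ≤ holderConst
    have hinv : (1 - NF * (θ₀ * g.M⁻¹) * B6.c1 d δ₀ α)⁻¹ ≤ 2 := by
      rw [inv_le_comm₀ (by linarith) (by norm_num : (0 : ℝ) < 2)]
      linarith
    have hA0 : 0 ≤ NH * Bl β * B6.c1 d δ₀ α := mul_nonneg (mul_nonneg hNH hb) hc1
    have h1 : NH * Bl β * B6.c1 d δ₀ α * (1 - NF * (θ₀ * g.M⁻¹) * B6.c1 d δ₀ α)⁻¹ ≤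
        holderConst d δ₀ α NH NF C (Bl β) (θH β) := by
      calc NH * Bl β * B6.c1 d δ₀ α * (1 - NF * (θ₀ * g.M⁻¹) * B6.c1 d δ₀ α)⁻¹
          ≤ NH * Bl β * B6.c1 d δ₀ α * 2 := mul_le_mul_of_nonneg_left hinv hA0
        _ = 2 * NH * Bl β * B6.c1 d δ₀ α := by ring
        _ ≤ holderConst d δ₀ α NH NF C (Bl β) (θH β) := by
            unfold holderConst
            have h0 : 0 ≤ NH * Bl β + NF * θH β * C * B6.c1 d δ₀ α :=
              add_nonneg (mul_nonneg hNH hb) (mul_nonneg (mul_nonneg (mul_nonneg hNF ht) hC) hc1)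
            linarith
    exact mul_le_mul (mul_le_mul_of_nonneg_right h1 (hW a)) (hexp a b) (Real.exp_nonneg _) (mul_nonneg hK (hW a))
  · -- NH·Bl + NF·θH·M⁻¹·C·c₁ ≤ holderConst (M ≥ 1)
    have h1 : NH * Bl β + NF * (θH β * g.M⁻¹) * C * B6.c1 d δ₀ α ≤ holderConst d δ₀ α NH NF C (Bl β) (θH β) := by
      unfold holderConst
      have h2 : NF * (θH β * g.M⁻¹) * C * B6.c1 d δ₀ α ≤ NF * θH β * C * B6.c1 d δ₀ α := by
        have h3 : θH β * g.M⁻¹ ≤ θH β := by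
          calc θH β * g.M⁻¹ ≤ θH β * 1 := mul_le_mul_of_nonneg_left hMinv ht
            _ = θH β := mul_one _
        have h4 : 0 ≤ C * B6.c1 d δ₀ α := mul_nonneg hC hc1
        calc NF * (θH β * g.M⁻¹) * C * B6.c1 d δ₀ α = NF * (θH β * g.M⁻¹) * (C * B6.c1 d δ₀ α) := by ring
          _ ≤ NF * θH β * (C * B6.c1 d δ₀ α) :=
              mul_le_mul_of_nonneg_right (mul_le_mul_of_nonneg_left h3 hNF) h4
          _ = NF * θH β * C * B6.c1 d δ₀ α := by ring
      have h5 : 0 ≤ 2 * NH * Bl β * B6.c1 d δ₀ α := by positivity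
      linarith
    exact mul_le_mul_of_nonneg_right (mul_le_mul_of_nonneg_right h1 (hW a)) (Real.exp_nonneg _)

omit [DecidableEq g.Site] in
/-- Downward monotonicity of a probe majorant of the printed shape: a larger constant and a slower rate (d ≧ 0, L^jη ≧ 0).
[folklore] -/
private theorem probeMaj_mono {W Z : Type} (blkW : W → g.Site) (blkZ : Z → g.Site) {T : (W → ℝ) →ₗ[ℝ] (Z → ℝ)}
    {c c' δ δ' β : ℝ} (h : HasMajorantHom (g := toB6 g R H) blkW blkZ T
      (fun (a b : g.Site) => c * g.len a ^ (1 - β) * Real.exp (-(δ * g.dist a b))))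
    (hcc' : c ≤ c') (hδ : δ' ≤ δ) (hdnn : ∀ a b : g.Site, 0 ≤ g.dist a b)
    (hlen : ∀ y : g.Site, 0 ≤ g.len y) (hc : 0 ≤ c) :
    HasMajorantHom (g := toB6 g R H) blkW blkZ T
      (fun (a b : g.Site) => c' * g.len a ^ (1 - β) * Real.exp (-(δ' * g.dist a b))) := by
  refine hasMajorantHom_mono (g := toB6 g R H) blkW blkZ h fun a b => ?_
  have hW : 0 ≤ g.len a ^ (1 - β) := Real.rpow_nonneg (hlen a) _
  have hexp : Real.exp (-(δ * g.dist a b)) ≤ Real.exp (-(δ' * g.dist a b)) :=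
    Real.exp_le_exp.mpr (neg_le_neg (mul_le_mul_of_nonneg_right hδ (hdnn a b)))
  exact mul_le_mul (mul_le_mul_of_nonneg_right hcc' hW) hexp (Real.exp_nonneg _)
    (mul_nonneg (hc.trans hcc') hW)

omit [Fintype g.Site] [DecidableEq g.Site] in
/-- Arithmetic of «for M sufficiently large»: M ≧ 2N_Fθ₀c₁ gives N_F·θ₀M⁻¹·c₁ ≦ ½ (twin of the private lemma of
`B9Thm310Whole`). [folklore] -/
private theorem small_of_threshold' {NF θ₀ c M : ℝ} (hM : 0 < M) (hbig : 2 * NF * θ₀ * c ≤ M) :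
    NF * (θ₀ * M⁻¹) * c ≤ 1 / 2 := by
  have h1 : NF * (θ₀ * M⁻¹) * c = (NF * θ₀ * c) / M := by
    rw [div_eq_mul_inv]
    ring
  rw [h1, div_le_iff₀ hM]
  linarith

omit [Fintype g.Site] [DecidableEq g.Site] in
/-- The six (3.46) lines from the lines n = 0, 1, 2 and the lines n ≧ 3 (bookkeeping; twin of the private splitter of
`B9RWSums346Schur`). [cite: Balaban1985BackgroundPropagators, (3.46) p.398] -/
private theorem l2lines_of_split' {K : B9.KernelFamily g B} {U : B.Cfg} {B₀ δ₀ : ℝ}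
    (h012 : (∀ (lam : g.Loc) (h : g.Cut) (y y' : g.Site), g.cutIn h y → g.suppIn lam y' →
        K.l2 0 U lam h ≤ B₀ * B9.pref6 (g.len y) 0 * g.cutSup h * Real.exp (-(δ₀ * g.dist y y')) * g.l2Norm lam) ∧
      (∀ (lam : g.Loc) (h : g.Cut) (y y' : g.Site), g.cutIn h y → g.suppIn lam y' →
        K.l2 1 U lam h ≤ B₀ * B9.pref6 (g.len y) 1 * g.cutSup h * Real.exp (-(δ₀ * g.dist y y')) * g.l2Norm lam) ∧
      (∀ (lam : g.Loc) (h : g.Cut) (y y' : g.Site), g.cutIn h y → g.suppIn lam y' →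
        K.l2 2 U lam h ≤ B₀ * B9.pref6 (g.len y) 2 * g.cutSup h * Real.exp (-(δ₀ * g.dist y y')) * g.l2Norm lam))
    (h345 : ∀ (n : Fin 6), 3 ≤ n.val → ∀ (lam : g.Loc) (h : g.Cut) (y y' : g.Site), g.cutIn h y → g.suppIn lam y' →
        K.l2 n U lam h ≤ B₀ * B9.pref6 (g.len y) n * g.cutSup h * Real.exp (-(δ₀ * g.dist y y')) * g.l2Norm lam) :
    ∀ (n : Fin 6) (lam : g.Loc) (h : g.Cut) (y y' : g.Site), g.cutIn h y → g.suppIn lam y' →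
      K.l2 n U lam h ≤ B₀ * B9.pref6 (g.len y) n * g.cutSup h * Real.exp (-(δ₀ * g.dist y y')) * g.l2Norm lam := by
  obtain ⟨h0, h1, h2⟩ := h012
  intro n
  fin_cases n
  · exact h0
  · exact h1
  · exact h2
  · exact h345 3 (by decide)
  · exact h345 4 (by decide)
  · exact h345 5 (by decide)

end GSide

/-! ### The leaf at the all-blocks pin with (3.43) proved inside -/

section AllPins

variable {I : Type} {c35 : ℝ} {geo : I → B9.Geometry} {bg : I → B9.Backgrounds}
variable [∀ i, Fintype (geo i).Site] [∀ i, DecidableEq (geo i).Site]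

/-- ★ **THEOREM 3.10 AT THE ALL-BLOCKS PIN WITH (3.42) + (3.47) + (3.46)₁,₂,₃ + (3.43) PROVED INSIDE** — the sibling
`B9RWSums346Schur.thm310Printed_allPin_schur` with the displayed residual shrunk further: only the input-side Hölder lines
(3.44), (3.45) and the L² lines (3.46)₄,₅,₆ of `K i` remain displayed (`hrest`).  Inputs beyond the sibling's: the probe letters
`𝔭 i` and the co-readings `H1Reads` of `(K i).h1` by (∇_UG(U), G(U)∇\*_U) through them; per member and per U under Corollary
3.6's provisos (M ≧ M₁, 0 < α₀, O(1)Mα₀ ≦ a₁, (3.35)) the factor bounds and the structure of (3.105) (`Factors389`,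
`Identities310` — the SAME packages `thm310Printed_of_local3107` consumes), the Hölder legs of the head terms (`HolderLegs310`)
and the probe bounds of the transposed factors (`FactorsHolder310`) at Cor. 3.6's rate δ₁; the static data, the overlap count
N_H of the legs' localizations, [4] (2.61) at (δ₁, α₁) for M ≧ M_L; the Conv3107 rate δ with 0 ≦ δ ≦ (1 − α₁)δ₁; and the
family's Hölder constant B₀(β) ≧ `holderConst …`(β).  «M sufficiently large»: M′ := max(M_g, M_r, M₁, M_L, 1, 2N_Fθ₀c₁(α₁));
a′ := min(a_r, a₁∕O(1)).  Nothing of print asserted; NOT a node discharge.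
[cite: Balaban1985BackgroundPropagators, Thm 3.10 (3.105)–(3.108) pp.414–416 + (3.42)–(3.47) pp.397–398 + Cor. 3.6 p.408 + p.413; Balaban1984PropagatorsII, Lemma 2.1 (2.61) p.234] -/
theorem thm310Printed_allPin_schur_holder {X Y ι A PX PY : I → Type} [∀ i, Fintype (X i)] [∀ i, DecidableEq (X i)]
    [∀ i, Fintype (Y i)] [∀ i, DecidableEq (Y i)] [∀ i, Fintype (ι i)] [∀ i, Fintype (A i)] [∀ i, Fintype (PX i)]
    [∀ i, DecidableEq (PX i)] [∀ i, Fintype (PY i)] [∀ i, DecidableEq (PY i)]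
    {𝔬 : ∀ i, Ops310 (geo i) (bg i) (X i) (Y i) (ι i) (A i)}
    {rd : ∀ i, WalkReading310 (geo i) (bg i) (X i) (ι i) (A i)} {R : I → ℝ} {H : I → Prop} {C δ : ℝ}
    (𝔭 : ∀ i, HolderProbes (geo i) (bg i) (X i) (Y i) (PX i) (PY i))
    (K : ∀ i, B9.KernelFamily (geo i) (bg i)) (ev : ∀ i, (geo i).Loc → X i → ℝ) (evY : ∀ i, (geo i).Loc → Y i → ℝ)
    {d : ℕ} {α L₀ B₀ δ₀ Mg Mr ar : ℝ} {Bβ Bε : ℝ → ℝ} {Bεβ : ℝ → ℝ → ℝ}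
    (κ : I → Sizes310) (SH : ∀ i, ι i → Finset (geo i).Site) (Bl θH : ℝ → ℝ) (d₁ : ℕ)
    (δ₁ α₁ ρ N N' NF Cℓ θ₀ NH a₁ M₁ ML : ℝ)
    (h310 : B9.Thm310Printed c35 geo bg (fun i => W310OfOps (𝔬 i) (rd i) (Conv3107 (𝔬 i) (R i) (H i) C δ)))
    (hco0 : ∀ i U, CoRealizes (K i) 0 U (𝔬 i).blk (𝔬 i).blk (ev i) ((𝔬 i).G U))
    (hco1 : ∀ i U, CoRealizes (K i) 1 U (𝔬 i).blkY (𝔬 i).blk (ev i) ((𝔬 i).D U ∘ₗ (𝔬 i).G U))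
    (hco2 : ∀ i U, CoRealizes (K i) 2 U (𝔬 i).blk (𝔬 i).blkY (evY i) ((𝔬 i).G U ∘ₗ (𝔬 i).Dstar U))
    (hco3 : ∀ i U, CoRealizes (K i) 3 U (𝔬 i).blk (𝔬 i).blk (ev i) ((𝔬 i).Lap U ∘ₗ (𝔬 i).G U))
    (hgl0 : ∀ i U, GlobReads (K i) 0 U (𝔬 i).blk (𝔬 i).blk (ev i) ((𝔬 i).G U))
    (hgl1 : ∀ i U, GlobReads (K i) 1 U (𝔬 i).blkY (𝔬 i).blk (ev i) ((𝔬 i).D U ∘ₗ (𝔬 i).G U))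
    (hgl2 : ∀ i U, GlobReads (K i) 2 U (𝔬 i).blk (𝔬 i).blkY (evY i) ((𝔬 i).G U ∘ₗ (𝔬 i).Dstar U))
    (hgl3 : ∀ i U, GlobReads (K i) 3 U (𝔬 i).blk (𝔬 i).blk (ev i) ((𝔬 i).Lap U ∘ₗ (𝔬 i).G U))
    (hl0 : ∀ i U, L2Reads (R := R i) (H := H i) (K i) 0 U (𝔬 i).blk (𝔬 i).blk (ev i) ((𝔬 i).G U))
    (hl1 : ∀ i U, L2Reads (R := R i) (H := H i) (K i) 1 U (𝔬 i).blkY (𝔬 i).blk (ev i) ((𝔬 i).D U ∘ₗ (𝔬 i).G U))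
    (hl2 : ∀ i U, L2Reads (R := R i) (H := H i) (K i) 2 U (𝔬 i).blk (𝔬 i).blkY (evY i) ((𝔬 i).G U ∘ₗ (𝔬 i).Dstar U))
    (hH1 : ∀ i U, H1Reads (K i) U (𝔭 i) (𝔬 i).blk (𝔬 i).blkY (ev i) (evY i) ((𝔬 i).D U ∘ₗ (𝔬 i).G U)
      ((𝔬 i).G U ∘ₗ (𝔬 i).Dstar U))
    (hsym : ∀ i U, IsTransposePair ((𝔬 i).G U) ((𝔬 i).G U))
    (htr : ∀ i U, IsTransposePair ((𝔬 i).D U ∘ₗ (𝔬 i).G U) ((𝔬 i).G U ∘ₗ (𝔬 i).Dstar U))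
    (hfacts : ∀ i, Mg ≤ (geo i).M → Facts347 (geo i) (R i) (H i) d δ α L₀)
    (hdsymm : ∀ i (a b : (geo i).Site), (geo i).dist a b = (geo i).dist b a)
    (hC : 0 ≤ C) (hCB : C ≤ B₀) (hCL : C * L₀ ≤ B₀) (hδ₀ : δ₀ ≤ (1 - α) * δ) (hα : 0 ≤ α * δ)
    (hCg : C * B6.c1 d δ (1 - α) * L₀ ^ (4 : ℝ) ≤ B₀) (har : 0 < ar)
    -- the Hölder inputs
    (hc : 0 < c35) (ha₁ : 0 < a₁) (hα₁ : 0 ≤ α₁) (hα₁1 : α₁ ≤ 1) (hNF : 0 ≤ NF) (hθ₀ : 0 ≤ θ₀) (hNH : 0 ≤ NH)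
    (hδnn : 0 ≤ δ) (hδδ₁ : δ ≤ (1 - α₁) * δ₁) (hδ₁ : 0 ≤ δ₁)
    (hst : ∀ i, StaticOK310 (𝔬 i) ρ N N' NF Cℓ (κ i))
    (hcntH : ∀ i (a : (geo i).Site), (∑ q, if a ∈ SH i q then (1 : ℝ) else 0) ≤ NH)
    (hBl : ∀ β, 0 ≤ β → β < 1 → 0 ≤ Bl β) (hθH : ∀ β, 0 ≤ β → β < 1 → 0 ≤ θH β)
    (hBβ : ∀ β, 0 ≤ β → β < 1 → holderConst d₁ δ₁ α₁ NH NF C (Bl β) (θH β) ≤ Bβ β)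
    (h261 : ∀ i, ML ≤ (geo i).M → Ineq261 d₁ (toB6 (geo i) (R i) (H i)) δ₁ α₁)
    (hop : ∀ i, M₁ ≤ (geo i).M → ∀ α₀ : ℝ, 0 < α₀ → c35 * (geo i).M * α₀ ≤ a₁ →
      ∀ U : (bg i).Cfg, (bg i).Reg335 c35 α₀ U →
        Factors389 (𝔬 i) (R i) (H i) θ₀ δ₁ U ∧ Identities310 (𝔬 i) (R i) (H i) U ∧
          HolderLegs310 (𝔬 i) (𝔭 i) (R i) (H i) (SH i) Bl δ₁ U ∧ FactorsHolder310 (𝔬 i) (𝔭 i) (R i) (H i) θH δ₁ U)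
    -- the displayed residual: (3.44), (3.45), (3.46)₄₅₆
    (hrest : ∀ i, Mr ≤ (geo i).M → ∀ α₀ : ℝ, 0 < α₀ → (geo i).M * α₀ ≤ ar → ∀ U : (bg i).Cfg, (bg i).Reg335 c35 α₀ U →
      (∀ (ε : ℝ) (lam : (geo i).Loc) (y y' : (geo i).Site), 0 < ε → ε ≤ 1 → (geo i).suppInT lam y' →
          (K i).e4 U lam y ≤ Bε ε * Real.exp (-(δ₀ * (geo i).dist y y')) * ((geo i).holder ε lam + (geo i).supNorm lam)) ∧
        (∀ (ε β : ℝ) (lam : (geo i).Loc) (ζ : (geo i).Cut) (y y' : (geo i).Site), 0 < ε → ε ≤ 1 → 0 ≤ β → β < 1 →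
          (geo i).cutInT ζ y → (geo i).suppInT lam y' →
          (K i).h2 U lam β ζ ≤ Bεβ ε β * ((geo i).len y) ^ (-β) * (geo i).cutH β ζ *
            Real.exp (-(δ₀ * (geo i).dist y y')) * ((geo i).holder (β + ε) lam + (geo i).supNorm lam)) ∧
        ∀ (n : Fin 6), 3 ≤ n.val → ∀ (lam : (geo i).Loc) (h : (geo i).Cut) (y y' : (geo i).Site), (geo i).cutIn h y →
          (geo i).suppIn lam y' →
          (K i).l2 n U lam h ≤ B₀ * B9.pref6 ((geo i).len y) n * (geo i).cutSup h * Real.exp (-(δ₀ * (geo i).dist y y')) *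
            (geo i).l2Norm lam) :
    B9.Thm310Printed c35 geo bg
      (fun i => W310OfOps (𝔬 i) (rd i) (ConvAll3107 (𝔬 i) (R i) (H i) C δ (K i) B₀ δ₀ Bβ Bε Bεβ)) := by
  have hδ₀' : δ₀ ≤ δ := hδ₀.trans (by nlinarith [hα])
  set Mbig : ℝ := 2 * NF * θ₀ * B6.c1 d₁ δ₁ α₁ with hMbig
  refine thm310Printed_W310OfOps_strengthen h310 (max (max Mg Mr) (max (max M₁ ML) (max 1 Mbig))) (min ar (a₁ / c35))
    (lt_min har (div_pos ha₁ hc)) fun i hM α₀ hα₀ hMa U hU hconv => ?_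
  have hMg : Mg ≤ (geo i).M := le_trans (le_trans (le_max_left _ _) (le_max_left _ _)) hM
  have hMr : Mr ≤ (geo i).M := le_trans (le_trans (le_max_right _ _) (le_max_left _ _)) hM
  have hM₁i : M₁ ≤ (geo i).M := le_trans (le_trans (le_trans (le_max_left _ _) (le_max_left _ _)) (le_max_right _ _)) hM
  have hMLi : ML ≤ (geo i).M := le_trans (le_trans (le_trans (le_max_right _ _) (le_max_left _ _)) (le_max_right _ _)) hM
  have hM1 : 1 ≤ (geo i).M := le_trans (le_trans (le_trans (le_max_left _ _) (le_max_right _ _)) (le_max_right _ _)) hM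
  have hMb : Mbig ≤ (geo i).M := le_trans (le_trans (le_trans (le_max_right _ _) (le_max_right _ _)) (le_max_right _ _)) hM
  have hMpos : 0 < (geo i).M := lt_of_lt_of_le one_pos hM1
  have ha : c35 * (geo i).M * α₀ ≤ a₁ := by
    have h1 : (geo i).M * α₀ * c35 ≤ a₁ := (le_div_iff₀ hc).mp (hMa.trans (min_le_right _ _))
    calc c35 * (geo i).M * α₀ = (geo i).M * α₀ * c35 := by ring
      _ ≤ a₁ := h1
  have hlen : ∀ y : (geo i).Site, 0 ≤ (geo i).len y := fun y => ((hst i).lenpos y).le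
  obtain ⟨hf, hi, hL, hF⟩ := hop i hM₁i α₀ hα₀ ha U hU
  obtain ⟨h344, h345, h346⟩ := hrest i hMr α₀ hα₀ (hMa.trans (min_le_left _ _)) U hU
  obtain ⟨h0, h1, h2, h3⟩ := hconv
  have hq : NF * (θ₀ * ((geo i).M)⁻¹) * B6.c1 d₁ δ₁ α₁ ≤ 1 / 2 := small_of_threshold' hMpos (by rw [hMbig] at hMb; exact hMb)
  -- the member (3.43): both probe majorants at (holderConst, δ), then at (Bβ, δ₀)
  have hH := holder343_of_local310 (𝔬 i) (𝔭 i) (R i) (H i) d₁ δ₁ α₁ ρ N N' NF Cℓ θ₀ NH C δ (κ i) (SH i) Bl θH U hδ₁ hα₁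
    hα₁1 hNF hθ₀ hNH hM1 hC hδnn hδδ₁ (hst i) (hcntH i) hBl hθH (h261 i hMLi) hq hf hi hL hF h2
  have hK0 : ∀ β, 0 ≤ β → β < 1 → 0 ≤ holderConst d₁ δ₁ α₁ NH NF C (Bl β) (θH β) := fun β hβ0 hβ1 =>
    holderConst_nonneg hNH hNF hC (hBl β hβ0 hβ1) (hθH β hβ0 hβ1)
  have hLβ : ∀ β, 0 ≤ β → β < 1 → HasMajorantHom (g := toB6 (geo i) (R i) (H i)) (𝔬 i).blk (𝔭 i).blkPY
      ((𝔭 i).ΦY U β ∘ₗ ((𝔬 i).D U ∘ₗ (𝔬 i).G U))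
      (fun (a b : (geo i).Site) => Bβ β * (geo i).len a ^ (1 - β) * Real.exp (-(δ₀ * (geo i).dist a b))) := by
    intro β hβ0 hβ1
    have h := (hH β hβ0 hβ1).1
    rw [LinearMap.comp_assoc] at h
    exact probeMaj_mono (𝔬 i).blk (𝔭 i).blkPY h (hBβ β hβ0 hβ1) hδ₀' (hst i).dnn hlen (hK0 β hβ0 hβ1)
  have hRβ : ∀ β, 0 ≤ β → β < 1 → HasMajorantHom (g := toB6 (geo i) (R i) (H i)) (𝔬 i).blkY (𝔭 i).blkPX
      ((𝔭 i).ΦX U β ∘ₗ ((𝔬 i).G U ∘ₗ (𝔬 i).Dstar U))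
      (fun (a b : (geo i).Site) => Bβ β * (geo i).len a ^ (1 - β) * Real.exp (-(δ₀ * (geo i).dist a b))) :=
    fun β hβ0 hβ1 => probeMaj_mono (𝔬 i).blkY (𝔭 i).blkPX (hH β hβ0 hβ1).2 (hBβ β hβ0 hβ1) hδ₀' (hst i).dnn hlen
      (hK0 β hβ0 hβ1)
  have hBβ0 : ∀ β, 0 ≤ β → β < 1 → 0 ≤ Bβ β := fun β hβ0 hβ1 => (hK0 β hβ0 hβ1).trans (hBβ β hβ0 hβ1)
  have h343 := line343_of_hasMajorantHom (R := R i) (H := H i) (hH1 i U) hBβ0 hlen hLβ hRβ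
  have h012 := l2lines012_of_majorants (𝔬 i).blk (𝔬 i).blkY (ev i) (evY i) h0 h1 h2 (hsym i U) (htr i U) (hl0 i U) (hl1 i U)
    (hl2 i U) (hfacts i hMg) (hdsymm i) ((hst i).dnn) ((hst i).lenpos) hC hCL hδ₀
  exact ⟨⟨h0, h1, h2, h3⟩, allIneqs_of_majorants (𝔬 i).blk (𝔬 i).blkY (ev i) (evY i) h0 h1 h2 h3 (hco0 i U) (hco1 i U)
    (hco2 i U) (hco3 i U) (hgl0 i U) (hgl1 i U) (hgl2 i U) (hgl3 i U) (hfacts i hMg) ((hst i).dnn) ((hst i).lenpos) hC hCB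
    hδ₀' hCg (ineq343_345_of_lines h343 h344 h345) (l2lines_of_split' h012 h346)⟩

end AllPins

end

end Literature.MathematicalPhysics.QuantumFieldTheory.Balaban1983to89.B9RWSums343Holder
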